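import Literature.AlgebraicGeometry.ShimuraVarieties.UnitaryShimuraCanonicalModel
import Literature.AlgebraicGeometry.ShimuraVarieties.ShimuraSetModelComponents
import Literature.AlgebraicGeometry.Motives.BaseChangeProofs
import Literature.AlgebraicGeometry.Motives.BaseChangePointsProofs
import Literature.AlgebraicGeometry.HodgeTheory.HodgeGenericQbarDescentProofs
import HarnessLib

/-!
# The complex fibre of Deligne's canonical-model record is a smooth projective MODEL of `Sh_K(ℂ)`

Topic `AlgebraicGeometry/ShimuraVarieties`; namespace `Literature.AlgebraicGeometry.ShimuraVarieties`,
grouping sub-namespace `UnitaryCanonicalModel` (the object of `UnitaryShimuraCanonicalModel`).  THEOREMS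
ONLY (no definition, no named fact, no `sorry`; T5: n/a — no theorem has two `Prop` hypothesis binders).

For a record `R : UnitaryCanonicalModel.Record L H τ T hT K` (one level) or a system
`S : UnitaryCanonicalModel.RecordSystem L H τ T hT K₀` (the small levels `K ≤ K₀`), the fields (F1) `smooth`,
`projective` (over `L`) and (F2a) `pts : M(ℂ)_{along τ} ≃ₜ Sh_K(ℂ)` are moved to the COMPLEX FIBRE
`M_τ = M ⊗_{L,τ} ℂ = (Motives.baseChangeHom τ).obj M` — the `ℂ`-scheme on which the record's own clauses
(F2b) `hol` and (from v5 on) (F2c) `pieces` are stated, and the input shape of the tree's component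
extraction `Deligne1979.exists_components_indexed` / `…_homeomorph_ballQuotient` (`ShimuraSetModelComponents`:
«let `X` be a complex scheme, smooth of relative dimension `d` over `ℂ` and projective, together with a
homeomorphism `e : X(ℂ) ≃ₜ Sh_K(ℂ)`»):

* `Record.smooth_complexFibre` / `RecordSystem.smooth_complexFibre` — `M_τ → Spec ℂ` is smooth of relative
  dimension `2` (base change of (F1); tree `HodgeTheory.smoothOfRelativeDimension_baseChangeHom_hom`,
  Liu 2002 Prop. 4.3.38);
* `Record.projective_complexFibre` / `RecordSystem.projective_complexFibre` — `M_τ` is projective over `ℂ`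
  (tree `Motives.IsProjectiveOver.baseChange_obj`, Liu 2002 Prop. 3.1.23);
* `Record.exists_homeomorph_complexFibre` / `RecordSystem.exists_homeomorph_complexFibre` — a homeomorphism
  `e : M_τ(ℂ) ≃ₜ Sh_K(ℂ)` through which `[z, aK]` corresponds to the point `AlgPoints.baseChangeEquiv τ M
  (pts⁻¹ [z, aK])` of `M_τ(ℂ)` — the SAME normalisation as the record's clauses (F2b)/(F2c) (the
  identification `M(ℂ) = M_τ(ℂ)` is a homeomorphism for the strong topologies: tree
  `AlgPoints.continuous_baseChangeEquiv`, `AlgPoints.continuous_baseChangeEquiv_symm`, i.e. the discharged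
  fact `AlgPoints.isHomeomorph_baseChangeEquiv_holds`; Conrad, *Weil and Grothendieck approaches to adelic
  points*, Prop. 2.1 / 3.1).

* **`RecordSystem.exists_components_homeomorph_ballQuotient`** (and the one-level `Record.…`) — [Deligne1979] 2.1.2 ON
  THE MODEL, as a THEOREM from (F1)+(F2a): for any representatives `g_q` of `Ξ_K`, the complex fibre `(M_K)_τ`
  is the disjoint union of open-and-closed subschemes `E_q ↪ (M_K)_τ`, `q ∈ Ξ_K`, each a smooth projective
  geometrically irreducible surface (`Motives.IsSmoothProjective 2`), whose complex points are a clopen partition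
  of `(M_K)_τ(ℂ)`, `E_q(ℂ) ≃ₜ Δ(Γ_H(g_qKg_q⁻¹)) \ 𝔹²` (the NATURAL levels), with `ι_q [z] = [z, g_qK]` in the
  record's normalisation — the tree's `Deligne1979.exists_components_homeomorph_ballQuotient`
  (`ShimuraSetModelComponents`, mc-binder-2) at `X := (M_K)_τ` with the three lemmas above.  This is the
  TOPOLOGICAL half of the record's (v5) clause `pieces`, derived rather than assumed.

Use (cells pub-hodgecm / pub-hodgecm2, S2 pinning record, TEAM hComp): the first three are the hypotheses
`[SmoothOfRelativeDimension 2 X.hom]`, `IsProjectiveOver X`, `e` of the (T2) theorems at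
`X := (baseChangeHom τ).obj (S.M.obj K)` (HCOMP-TABLE rows U3/U3⁺, reserve B), stated BY NAME so that the
component extraction applies to Deligne's model with no further glue.  Nothing here is a Hodge class, a
period or an `L`-value; HC_CM is not mentioned and not implied; no binder of any cell is discharged here.

References: Q. Liu, *Algebraic Geometry and Arithmetic Curves* (2002), Prop. 3.1.23, Prop. 4.3.38;
B. Conrad, *Weil and Grothendieck approaches to adelic points*, Enseign. Math. 58 (2012), Prop. 2.1, 3.1;
P. Deligne, *Variétés de Shimura* (1979) 2.1.2, 2.2.5 (the record).
-/

set_option autoImplicit false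

noncomputable section

open Function MulAction Topology NumberField IsDedekindDomain CategoryTheory AlgebraicGeometry Matrix
open scoped Matrix ComplexOrder
open Literature.AlgebraicGeometry.Motives
open Literature.NumberTheory.Automorphic Literature.NumberTheory.Automorphic.UnitaryGroup
open Literature.NumberTheory.Automorphic.Liu2021.AppendixC (C5.OpenCompactSubgroup C5.SmallLevel)
open Literature.Geometry.ComplexHyperbolic Literature.Geometry.ComplexHyperbolic.BallModel

namespace Literature.AlgebraicGeometry.ShimuraVarieties

namespace UnitaryCanonicalModel

variable {L : Type} [Field L] [NumberField L] [IsCMField L] {H : Matrix (Fin 3) (Fin 3) L}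
  {τ : L →+* ℂ} {T : GL (Fin 3) ℂ} {hT : formCongr (starRingEnd ℂ) T (H.map τ) = BallModel.J}

/-! ### One level -/

namespace Record

variable {K : Subgroup (finAdelic (↥(maximalRealSubfield L)) L (IsCMField.complexConj L) 3 H)}

/-- **The complex fibre `M_τ = M ⊗_{L,τ} ℂ` of the model is smooth of relative dimension `2` over `ℂ`**
(base change of (F1) `smooth`; Liu 2002 Prop. 4.3.38, tree `HodgeTheory.smoothOfRelativeDimension_baseChangeHom_hom`).
[cite: Liu2002, Prop. 4.3.38] -/
theorem smooth_complexFibre (R : Record L H τ T hT K) :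
    SmoothOfRelativeDimension 2 ((Motives.baseChangeHom τ).obj R.M).hom :=
  haveI := R.smooth
  HodgeTheory.smoothOfRelativeDimension_baseChangeHom_hom τ 2 R.M

/-- **The complex fibre `M_τ` is projective over `ℂ`** (base change of (F1) `projective`; Liu 2002 Prop. 3.1.23
with Ex. 3.1.10, tree `Motives.IsProjectiveOver.baseChange_obj`). [cite: Liu2002, Prop. 3.1.23 and Ex. 3.1.10] -/
theorem projective_complexFibre (R : Record L H τ T hT K) :
    IsProjectiveOver ((Motives.baseChangeHom τ).obj R.M) := by
  letI : Algebra L ℂ := τ.toAlgebra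
  exact R.projective.baseChange_obj ℂ

/-- **The complex points of `M_τ` are `Sh_K(ℂ)`**, with the record's normalisation: there is a homeomorphism
`e : M_τ(ℂ) ≃ₜ Sh_K(ℂ) = U(H)(L⁺) \ [𝔹² × U(H)(𝔸_{L⁺,f})/K]` with
`e⁻¹ [z, aK] = AlgPoints.baseChangeEquiv τ M (pts⁻¹ [z, aK])` — (F2a) `pts` composed with the identification
`M(ℂ)_{along τ} = M_τ(ℂ)`, a homeomorphism for the strong topologies (tree `AlgPoints.continuous_baseChangeEquiv`,
`AlgPoints.continuous_baseChangeEquiv_symm`; Conrad 2012 Prop. 2.1 / 3.1).  This `e` is the input of the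
tree's `Deligne1979.exists_components_homeomorph_ballQuotient` at `X := M_τ`, and its normalisation is that of
the record's clauses (F2b) `hol` / (F2c) `pieces`. [cite: ConradAdelicPoints2012, Prop. 2.1 and Prop. 3.1] -/
theorem exists_homeomorph_complexFibre (R : Record L H τ T hT K) :
    ∃ e : ComplexPoints ((Motives.baseChangeHom τ).obj R.M) ≃ₜ ShimuraSet L H τ T hT K,
      ∀ (z : Ball) (a : finAdelic (↥(maximalRealSubfield L)) L (IsCMField.complexConj L) 3 H),
        e.symm (ShimuraSet.mk L H τ T hT K z a) =
          (letI : Algebra L ℂ := τ.toAlgebra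
           AlgPoints.baseChangeEquiv τ R.M (R.pts.symm (ShimuraSet.mk L H τ T hT K z a))) := by
  letI : Algebra L ℂ := τ.toAlgebra
  let b : ComplexPoints R.M ≃ₜ ComplexPoints ((Motives.baseChangeHom τ).obj R.M) :=
    Homeomorph.mk (AlgPoints.baseChangeEquiv τ R.M) (AlgPoints.continuous_baseChangeEquiv τ R.M)
      (AlgPoints.continuous_baseChangeEquiv_symm τ R.M)
  exact ⟨b.symm.trans R.pts, fun z a => rfl⟩

end Record

/-! ### The system below `K₀` -/

namespace RecordSystem

variable {K₀ : C5.OpenCompactSubgroup ↥(finAdelic (↥(maximalRealSubfield L)) L (IsCMField.complexConj L) 3 H)}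

/-- At every small level `K ≤ K₀`: the complex fibre `(M_K)_τ` is smooth of relative dimension `2` over `ℂ`
(Liu 2002 Prop. 4.3.38). [cite: Liu2002, Prop. 4.3.38] -/
theorem smooth_complexFibre (S : RecordSystem L H τ T hT K₀) (K : C5.SmallLevel K₀) :
    SmoothOfRelativeDimension 2 ((Motives.baseChangeHom τ).obj (S.M.obj K)).hom :=
  (S.record L H τ T hT K).smooth_complexFibre

/-- At every small level `K ≤ K₀`: `(M_K)_τ` is projective over `ℂ` (Liu 2002 Prop. 3.1.23).
[cite: Liu2002, Prop. 3.1.23 and Ex. 3.1.10] -/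
theorem projective_complexFibre (S : RecordSystem L H τ T hT K₀) (K : C5.SmallLevel K₀) :
    IsProjectiveOver ((Motives.baseChangeHom τ).obj (S.M.obj K)) :=
  (S.record L H τ T hT K).projective_complexFibre

/-- At every small level `K ≤ K₀`: a homeomorphism `e : (M_K)_τ(ℂ) ≃ₜ Sh_K(ℂ)` with
`e⁻¹ [z, aK] = AlgPoints.baseChangeEquiv τ M_K ((pts K)⁻¹ [z, aK])` (the record's normalisation).
[cite: ConradAdelicPoints2012, Prop. 2.1 and Prop. 3.1] -/
theorem exists_homeomorph_complexFibre (S : RecordSystem L H τ T hT K₀) (K : C5.SmallLevel K₀) :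
    ∃ e : ComplexPoints ((Motives.baseChangeHom τ).obj (S.M.obj K)) ≃ₜ ShimuraSet L H τ T hT K.1.1,
      ∀ (z : Ball) (a : finAdelic (↥(maximalRealSubfield L)) L (IsCMField.complexConj L) 3 H),
        e.symm (ShimuraSet.mk L H τ T hT K.1.1 z a) =
          (letI : Algebra L ℂ := τ.toAlgebra
           AlgPoints.baseChangeEquiv τ (S.M.obj K) ((S.pts K).symm (ShimuraSet.mk L H τ T hT K.1.1 z a))) :=
  (S.record L H τ T hT K).exists_homeomorph_complexFibre

end RecordSystem

/-! ### Deligne 2.1.2 on the model: the components of the complex fibre (topological half of `pieces`) -/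

open Literature.NumberTheory.Automorphic.ShimuraDissection
open Literature.AlgebraicTopology.SingularHomology (IsClopenPartition)

namespace Record

variable {K : Subgroup (finAdelic (↥(maximalRealSubfield L)) L (IsCMField.complexConj L) 3 H)}

/-- **[Deligne 1979, 2.1.2] on Deligne's MODEL, one level** — «`_K M_ℂ(G,X)` … is a disjoint sum, indexed by
the finite set `G(ℚ)₊ \ G(𝔸^f)/K`, of the quotients `Γ_g \ X⁺` … `Γ'_g = gKg⁻¹ ∩ G(ℚ)₊`», read on the complex
fibre `M_τ` of a record `R : Record L H τ T hT K` with `K` OPEN, for ANY representatives `g_q` of `Ξ_K`: open-and-closed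
subschemes `E_q ↪ M_τ`, each `IsSmoothProjective 2`, whose complex points partition `M_τ(ℂ)` (clopen), land on the
piece `{[z, g_qK]}` under (F2a) read through `AlgPoints.baseChangeEquiv`, and are homeomorphic to the ball quotients
`Δ(Γ_H(g_qKg_q⁻¹)) \ 𝔹²` by the NATURAL arithmetic levels, with `ι_q (φ_q⁻¹ [z]) = AlgPoints.baseChangeEquiv τ M
(pts⁻¹ [z, g_qK])`.  A THEOREM (tree `Deligne1979.exists_components_homeomorph_ballQuotient` at `X := M_τ`, fed by
`smooth_complexFibre`, `projective_complexFibre`, `exists_homeomorph_complexFibre`); no clause of the record beyond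
(F1)/(F2a) is used. [cite: Deligne1979ShimuraVarieties, §2.1.2] [cite: Milne2005ShimuraVarieties, Lemma 5.13] -/
theorem exists_components_homeomorph_ballQuotient (R : Record L H τ T hT K)
    (hK : IsOpen (K : Set (finAdelic (↥(maximalRealSubfield L)) L (IsCMField.complexConj L) 3 H)))
    (g : orbitRel.Quotient (rational (↥(maximalRealSubfield L)) L (IsCMField.complexConj L) 3 H)
          (CosetSpace (rationalToFinAdelic (↥(maximalRealSubfield L)) L (IsCMField.complexConj L) 3 H) K) →
        finAdelic (↥(maximalRealSubfield L)) L (IsCMField.complexConj L) 3 H)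
    (hg : ∀ q, Quotient.mk'' (CosetSpace.pt (rationalToFinAdelic _ L _ 3 H) K (g q)) = q) :
    ∃ (E : orbitRel.Quotient (rational (↥(maximalRealSubfield L)) L (IsCMField.complexConj L) 3 H)
          (CosetSpace (rationalToFinAdelic (↥(maximalRealSubfield L)) L (IsCMField.complexConj L) 3 H) K) →
        SchemeOver ℂ)
      (ι : ∀ q, E q ⟶ (Motives.baseChangeHom τ).obj R.M)
      (φ : ∀ q, ComplexPoints (E q) ≃ₜ
        orbitRel.Quotient
          (archImageU21 L H τ T hT
            (arithmeticLevel (↥(maximalRealSubfield L)) L (IsCMField.complexConj L) 3 H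
              (K.map (MulAut.conj (g q)).toMonoidHom)))
          Ball),
      (∀ q, IsSmoothProjective 2 (E q)) ∧ (∀ q, IsOpenImmersion (ι q).left) ∧
        (∀ q, IsClosedImmersion (ι q).left) ∧
        IsClopenPartition (fun q => Set.range (AlgPoints.map (L := ℂ) (ι q))) ∧
        ∀ q (z : Ball), AlgPoints.map (L := ℂ) (ι q) ((φ q).symm (Quotient.mk'' z)) =
          (letI : Algebra L ℂ := τ.toAlgebra
           AlgPoints.baseChangeEquiv τ R.M (R.pts.symm (ShimuraSet.mk L H τ T hT K z (g q)))) := by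
  haveI := R.smooth_complexFibre
  obtain ⟨e, he⟩ := R.exists_homeomorph_complexFibre
  obtain ⟨E, ι, φ, hE, hopen, hclosed, hpart, -, hφ⟩ :=
    Deligne1979.exists_components_homeomorph_ballQuotient L H τ T hT K (d := 2) R.projective_complexFibre hK e g hg
  exact ⟨E, ι, φ, hE, hopen, hclosed, hpart, fun q z => (hφ q z).trans (he z (g q))⟩

end Record

namespace RecordSystem

variable {K₀ : C5.OpenCompactSubgroup ↥(finAdelic (↥(maximalRealSubfield L)) L (IsCMField.complexConj L) 3 H)}

/-- **[Deligne 1979, 2.1.2] on Deligne's MODEL, at every small level `K ≤ K₀`** (small levels are open): the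
components `E_q ↪ (M_K)_τ`, `q ∈ Ξ_K`, smooth projective geometrically irreducible surfaces partitioning the
complex points, homeomorphic to `Δ(Γ_H(g_qKg_q⁻¹)) \ 𝔹²` with `ι_q (φ_q⁻¹ [z]) = AlgPoints.baseChangeEquiv τ M_K
((pts K)⁻¹ [z, g_qK])` — the topological half of the record's clause `pieces`, as a THEOREM.
[cite: Deligne1979ShimuraVarieties, §2.1.2] [cite: Milne2005ShimuraVarieties, Lemma 5.13] -/
theorem exists_components_homeomorph_ballQuotient (S : RecordSystem L H τ T hT K₀) (K : C5.SmallLevel K₀)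
    (g : orbitRel.Quotient (rational (↥(maximalRealSubfield L)) L (IsCMField.complexConj L) 3 H)
          (CosetSpace (rationalToFinAdelic (↥(maximalRealSubfield L)) L (IsCMField.complexConj L) 3 H) K.1.1) →
        finAdelic (↥(maximalRealSubfield L)) L (IsCMField.complexConj L) 3 H)
    (hg : ∀ q, Quotient.mk'' (CosetSpace.pt (rationalToFinAdelic _ L _ 3 H) K.1.1 (g q)) = q) :
    ∃ (E : orbitRel.Quotient (rational (↥(maximalRealSubfield L)) L (IsCMField.complexConj L) 3 H)
          (CosetSpace (rationalToFinAdelic (↥(maximalRealSubfield L)) L (IsCMField.complexConj L) 3 H) K.1.1) →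
        SchemeOver ℂ)
      (ι : ∀ q, E q ⟶ (Motives.baseChangeHom τ).obj (S.M.obj K))
      (φ : ∀ q, ComplexPoints (E q) ≃ₜ
        orbitRel.Quotient
          (archImageU21 L H τ T hT
            (arithmeticLevel (↥(maximalRealSubfield L)) L (IsCMField.complexConj L) 3 H
              (K.1.1.map (MulAut.conj (g q)).toMonoidHom)))
          Ball),
      (∀ q, IsSmoothProjective 2 (E q)) ∧ (∀ q, IsOpenImmersion (ι q).left) ∧
        (∀ q, IsClosedImmersion (ι q).left) ∧
        IsClopenPartition (fun q => Set.range (AlgPoints.map (L := ℂ) (ι q))) ∧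
        ∀ q (z : Ball), AlgPoints.map (L := ℂ) (ι q) ((φ q).symm (Quotient.mk'' z)) =
          (letI : Algebra L ℂ := τ.toAlgebra
           AlgPoints.baseChangeEquiv τ (S.M.obj K) ((S.pts K).symm (ShimuraSet.mk L H τ T hT K.1.1 z (g q)))) :=
  (S.record L H τ T hT K).exists_components_homeomorph_ballQuotient K.1.2.1 g hg

end RecordSystem

end UnitaryCanonicalModel

end Literature.AlgebraicGeometry.ShimuraVarieties

end
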